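import Literature.Computability.Complexity.FKPointLocationUpdFP
import HarnessLib

/-!
# Fournier–Koiran point location, XIV: the schedule and the replayed state are polynomial-time

Topic `Literature/Computability/Complexity`, grouping namespace `FKPointLocation`. The oracle
algorithm of Fournier–Koiran's Theorem 3 (ICALP 2000 = LIP RR-1999-21, p. 4 and p. 11) recomputes,
before each query, the state of the location protocol from the answer bits received so far. On the
untyped side (`FKPointLocationUntyped.lean`) this is

* the SCHEDULE `uagenda P` (levels `0, …, D`, `ulevelTasks`) as a typed polynomial-time program on
  the unary parameter record (`ulevelTasksFP`, `uagendaFP`; task constructors `task_bs`, …);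
* the REPLAYED STATE `ustate P prev`: the fold of the transition `uupd` (`FKPointLocationUpdFP.uupdFP`)
  over the scheduled tasks paired with the answers `prev` (tasks beyond `|prev|` are idle; a guard
  on the task arguments, always passed on the schedule, keeps the size invariant
  `FKPointLocationSizes.USz` available on every input), its semantics `ustate_eq_foldl_zip`, and
  **`ustateFP`**: `(P, prev) ↦ ustate P prev` is computed in polynomial time — the accumulator of the
  fold has polynomially bounded code along the run (`usz_ustep_foldl`, `length_dataE_le`,
  `dataSize_le_poly`).

## References

* H. Fournier, P. Koiran, *Lower bounds are not easier over the reals: inside PH*, ICALP 2000,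
  LNCS 1853 = LIP RR-1999-21, §2.1–2.2, Thm 3 (p. 11). [FournierKoiran2000]
* S. Arora, B. Barak, *Computational Complexity: A Modern Approach*, CUP 2009, §1.3 (polynomially
  bounded loops). [AroraBarak2009]
-/

namespace Literature.Computability.Complexity

namespace FKPointLocation

open _root_.Computability CodeFP Polynomial

/-! ### Task constructors on codes -/

section Tasks

variable {α : Type} {eα : α → List Bool}

/-- A task from its computed tag and argument list. [folklore] -/
theorem taskOf {τ : α → UTask} (h : CodeFP eα (pairE natE (rawE natE)) (fun a => ((τ a).tag, (τ a).args))) :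
    CodeFP eα taskE τ := by
  obtain ⟨f, hf, hfτ⟩ := h; exact ⟨f, hf, hfτ⟩

/-- A task with one argument, from the argument. [folklore] -/
theorem task_un (c : ℕ → UTask) (k : ℕ) (hc : ∀ i, (c i).tag = k ∧ (c i).args = [i]) : CodeFP natE taskE c :=
  taskOf (((const natE k).pair ((rawSingleton natE).comp (CodeFP.id natE))).congr fun i => by
    rw [(hc i).1, (hc i).2]; rfl)

/-- `bs i k` from `(i, k)`. [folklore] -/
theorem task_bs : CodeFP (pairE natE natE) taskE (fun p => UTask.bs p.1 p.2) :=
  taskOf (((const _ 0).pair ((rawCons natE).comp ((fst _ _).pair ((rawSingleton natE).comp (snd _ _))))).congr fun _ => rfl)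

/-- `ex sc m` from `(sc, m)`. [folklore] -/
theorem task_ex : CodeFP (pairE natE natE) taskE (fun p => UTask.ex p.1 p.2) :=
  taskOf (((const _ 1).pair ((rawCons natE).comp ((fst _ _).pair ((rawSingleton natE).comp (snd _ _))))).congr fun _ => rfl)

/-- `pf sc m w` from `(sc, m, w)`. [folklore] -/
theorem task_pf : CodeFP (pairE natE (pairE natE natE)) taskE (fun p => UTask.pf p.1 p.2.1 p.2.2) :=
  taskOf (((const _ 2).pair ((rawCons natE).comp ((fst _ _).pair ((rawCons natE).comp ((snd _ _).fst'.pair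
    ((rawSingleton natE).comp (snd _ _).snd')))))).congr fun _ => rfl)

/-- `st sc`. [folklore] -/
theorem task_st : CodeFP natE taskE UTask.st := task_un UTask.st 3 fun _ => ⟨rfl, rfl⟩
/-- `ap w`. [folklore] -/
theorem task_ap : CodeFP natE taskE UTask.ap := task_un UTask.ap 4 fun _ => ⟨rfl, rfl⟩
/-- `eqGe i`. [folklore] -/
theorem task_eqGe : CodeFP natE taskE UTask.eqGe := task_un UTask.eqGe 5 fun _ => ⟨rfl, rfl⟩
/-- `eqLe i`. [folklore] -/
theorem task_eqLe : CodeFP natE taskE UTask.eqLe := task_un UTask.eqLe 6 fun _ => ⟨rfl, rfl⟩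
/-- `fa i`. [folklore] -/
theorem task_fa : CodeFP natE taskE UTask.fa := task_un UTask.fa 7 fun _ => ⟨rfl, rfl⟩

end Tasks

/-! ### The schedule -/

section Agenda

/-- The context of the level schedule: parameters and level index. [folklore] -/
private abbrev LvE : UParams × ℕ → List Bool := pairE paramsE natE

/-- The binary-search tasks of a level. [cite: FournierKoiran2000, §2.1 Step 1] -/
theorem levelBsFP : CodeFP LvE (rawE taskE)
    (fun p => (List.range p.1.D).flatMap fun i => (List.range (p.1.L + 1)).map (UTask.bs i)) := by
  have hinner : CodeFP (pairE LvE natE) (rawE taskE) (fun t => (List.range (t.1.1.L + 1)).map (UTask.bs t.2)) :=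
    ((map (task_bs.comp ((fst _ _).snd'.pair (snd _ _)))).comp ((CodeFP.id _).pair
      (urange.comp (unSucc.comp (params_L.comp (fst _ _).fst'))))).congr fun t => rfl
  exact (((flatten taskE).comp ((map hinner).comp ((CodeFP.id _).pair (urange.comp (params_D.comp (fst _ _)))))) :).congr
    fun p => by simp only [id, List.flatMap_def]

/-- The search tasks of a level (chain slots with prefix bits, stability). [cite: FournierKoiran2000, §2.1 Step k] -/
theorem levelSearchFP : CodeFP LvE (rawE taskE)
    (fun p => (List.range (p.1.D + 1)).flatMap fun sc =>
      ((List.range (p.1.D + 1)).flatMap fun m => UTask.ex sc m :: (List.range p.1.Wf).map (UTask.pf sc m)) ++ [UTask.st sc]) := by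
  -- context `((P, j), sc)` and item `m`
  have hpf : CodeFP (pairE (pairE (pairE LvE natE) natE) natE) taskE (fun t => UTask.pf t.1.1.2 t.1.2 t.2) :=
    (task_pf.comp ((fst _ _).fst'.snd'.pair ((fst _ _).snd'.pair (snd _ _))) :)
  have hslot : CodeFP (pairE (pairE LvE natE) natE) (rawE taskE)
      (fun t => UTask.ex t.1.2 t.2 :: (List.range t.1.1.1.Wf).map (UTask.pf t.1.2 t.2)) :=
    ((rawCons taskE).comp ((task_ex.comp ((fst _ _).snd'.pair (snd _ _))).pair ((map hpf).comp ((CodeFP.id _).pair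
      (urange.comp (params_Wf.comp (fst _ _).fst'.fst')))))).congr fun t => rfl
  have hsc : CodeFP (pairE LvE natE) (rawE taskE)
      (fun t => ((List.range (t.1.1.D + 1)).flatMap fun m => UTask.ex t.2 m :: (List.range t.1.1.Wf).map (UTask.pf t.2 m)) ++ [UTask.st t.2]) :=
    ((rawAppend taskE).comp ((((flatten taskE).comp ((map hslot).comp ((CodeFP.id _).pair
      (urange.comp (unSucc.comp (params_D.comp (fst _ _).fst')))))).pair ((rawSingleton taskE).comp (task_st.comp (snd _ _)))))).congr
      fun t => by simp only [id, List.flatMap_def]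
  exact (((flatten taskE).comp ((map hsc).comp ((CodeFP.id _).pair (urange.comp (unSucc.comp (params_D.comp (fst _ _))))))) :).congr
    fun p => by simp only [id, List.flatMap_def]

/-- **The tasks of level `j`** are computed in polynomial time from `(P, j)`. [cite: FournierKoiran2000, §2.1] -/
theorem ulevelTasksFP : CodeFP LvE (rawE taskE) (fun p => ulevelTasks p.1 p.2) := by
  have hD : CodeFP LvE unE (fun p => p.1.D) := (params_D.comp (fst _ _) :)
  have hap : CodeFP LvE (rawE taskE) (fun p => (List.range p.1.Wa).map UTask.ap) :=
    ((map₀ task_ap).comp (urange.comp (params_Wa.comp (fst _ _))) :)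
  have heq : CodeFP LvE (rawE taskE) (fun p => (List.range p.1.D).flatMap fun i => [UTask.eqGe i, UTask.eqLe i]) :=
    (((flatten taskE).comp ((map₀ ((rawCons taskE).comp (task_eqGe.pair ((rawSingleton taskE).comp task_eqLe)))).comp
      (urange.comp hD))) :).congr fun p => by rw [List.flatMap_def]
  have hfa : CodeFP LvE (rawE taskE) (fun p => (List.range p.1.D).map UTask.fa) := ((map₀ task_fa).comp (urange.comp hD) :)
  have hj0 : CodeFP LvE bitE (fun p => decide (p.2 = 0)) := (natEq.comp ((snd _ _).pair (const LvE 0)) :)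
  have hsearch : CodeFP LvE (rawE taskE) (fun p => if p.2 = 0 then [] else
      ((List.range p.1.D).flatMap fun i => (List.range (p.1.L + 1)).map (UTask.bs i)) ++
      ((List.range (p.1.D + 1)).flatMap fun sc =>
        ((List.range (p.1.D + 1)).flatMap fun m => UTask.ex sc m :: (List.range p.1.Wf).map (UTask.pf sc m)) ++ [UTask.st sc]) ++
      (List.range p.1.Wa).map UTask.ap) :=
    (hj0.ite (const LvE ([] : List UTask)) ((rawAppend taskE).comp (((rawAppend taskE).comp (levelBsFP.pair levelSearchFP)).pair hap))).congr
      fun p => by simp only [decide_eq_true_eq]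
  exact (((rawAppend taskE).comp (((rawAppend taskE).comp (((rawAppend taskE).comp (hsearch.pair heq)).pair hfa)).pair
    (const LvE [UTask.close])) :)).congr fun p => by simp only [ulevelTasks, List.append_assoc]

/-- **The schedule is computed in polynomial time** from the parameters. [cite: FournierKoiran2000, §2.1, Thm 3] -/
theorem uagendaFP : CodeFP paramsE (rawE taskE) uagenda :=
  (((flatten taskE).comp ((map ulevelTasksFP).comp ((CodeFP.id _).pair (urange.comp (unSucc.comp params_D))))) :).congr
    fun P => by rw [uagenda, List.flatMap_def]; rfl

end Agenda

/-! ### The replayed state -/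

section State

/-- The guard on task arguments (always passed on the schedule). [folklore] -/
def argsLeB (τ : UTask) (A : ℕ) : Bool := τ.args.all fun a => decide (a ≤ A)

/-- The guard is the predicate `ArgsLe`. [folklore] -/
theorem argsLeB_iff (τ : UTask) (A : ℕ) : argsLeB τ A = true ↔ τ.ArgsLe A := by
  simp [argsLeB, UTask.ArgsLe]

/-- One replay step on the indexed task `(i, τ)`: apply the transition with the answer `prev[i]` if
there is one and the guard passes, else idle. [cite: FournierKoiran2000, §2.1] -/
def ustep (P : UParams) (prev : List Bool) (t : ℕ × UTask) (d : UData) : UData :=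
  if decide (t.1 < prev.length) && argsLeB t.2 P.amax then uupd P d t.2 (prev.getD t.1 false) else d

/-- **The state of the location protocol replayed from the answers `prev`.** [cite: FournierKoiran2000, §2.1, Thm 3 (p. 11)] -/
def ustate (P : UParams) (prev : List Bool) : UData :=
  ((List.range (uagenda P).length).zip (uagenda P)).foldl (fun d t => ustep P prev t d) (UData.init P.D)

/-- Folding the indexed steps over a guarded list is folding the transition over the list zipped
with the answers. [folklore] -/
theorem foldl_ustep_eq (P : UParams) (prev : List Bool) :
    ∀ (l : List UTask) (k : ℕ) (d : UData), (∀ τ ∈ l, τ.ArgsLe P.amax) →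
      (((List.range l.length).map (· + k)).zip l).foldl (fun d t => ustep P prev t d) d =
        (l.zip (prev.drop k)).foldl (fun d s => uupd P d s.1 s.2) d
  | [], k, d, _ => by simp
  | τ :: l, k, d, hl => by
    have hτ : argsLeB τ P.amax = true := (argsLeB_iff τ _).2 (hl τ (by simp))
    rw [List.length_cons, List.range_succ_eq_map, List.map_cons, List.zip_cons_cons, List.foldl_cons, Nat.zero_add,
      List.map_map]
    have hshift : ((List.range l.length).map ((· + k) ∘ Nat.succ)) = (List.range l.length).map (· + (k + 1)) :=
      List.map_congr_left fun i _ => by simp only [Function.comp_apply, Nat.succ_eq_add_one]; ring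
    rw [hshift]
    by_cases hk : k < prev.length
    · have hstep : ustep P prev (k, τ) d = uupd P d τ (prev.getD k false) := by simp [ustep, hk, hτ]
      have hb : prev.drop k = prev.getD k false :: prev.drop (k + 1) := by
        rw [List.drop_eq_getElem_cons hk, List.getD_eq_getElem _ _ hk]
      rw [hstep, hb, List.zip_cons_cons, List.foldl_cons]
      exact foldl_ustep_eq P prev l (k + 1) _ (fun τ' h => hl τ' (by simp [h]))
    · push Not at hk
      have hstep : ustep P prev (k, τ) d = d := by simp [ustep, not_lt.2 hk]
      rw [hstep, List.drop_eq_nil_of_le hk, List.zip_nil_right, List.foldl_nil]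
      have := foldl_ustep_eq P prev l (k + 1) d (fun τ' h => hl τ' (by simp [h]))
      rw [this, List.drop_eq_nil_of_le (by omega), List.zip_nil_right, List.foldl_nil]

/-- **Semantics of the replayed state**: the transition folded over the scheduled tasks paired with
the answers (the shorter list wins). [cite: FournierKoiran2000, §2.1] -/
theorem ustate_eq_foldl_zip (P : UParams) (prev : List Bool) :
    ustate P prev = ((uagenda P).zip prev).foldl (fun d s => uupd P d s.1 s.2) (UData.init P.D) := by
  have h := foldl_ustep_eq P prev (uagenda P) 0 (UData.init P.D) (fun τ hτ => argsLe_of_mem_uagenda P hτ)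
  simp only [Nat.add_zero, List.map_id', List.drop_zero] at h
  exact h

/-! ### Size along the replay -/

/-- The size invariant along the guarded replay, from any bounded state. [cite: FournierKoiran2000, §2.2] -/
theorem usz_ustep_foldl (P : UParams) (prev : List Bool) {K : ℕ} (hK : P.K₀ ≤ K) :
    ∀ (l : List (ℕ × UTask)) (t : ℕ) (d : UData), USz P (K + 3 * t) t d →
      USz P (K + 3 * (t + l.length)) (t + l.length) (l.foldl (fun d s => ustep P prev s d) d)
  | [], t, d, h => by simpa using h
  | s :: l, t, d, h => by
    rw [List.foldl_cons]
    have h1 : USz P (K + 3 * (t + 1)) (t + 1) (ustep P prev s d) := by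
      unfold ustep
      split_ifs with hg
      · have hargs : s.2.ArgsLe P.amax := (argsLeB_iff _ _).1 (Bool.and_eq_true_iff.1 hg).2
        have := usz_uupd h (hK.trans (Nat.le_add_right _ _)) s.2 hargs (prev.getD s.1 false)
        have e : K + 3 * t + 3 = K + 3 * (t + 1) := by ring
        rw [e] at this; exact this
      · exact h.mono (by omega) (by omega)
    have := usz_ustep_foldl P prev hK l (t + 1) _ h1
    have e : t + 1 + l.length = t + (l.length + 1) := by ring
    rw [List.length_cons, ← e]; exact this

/-- The unary fields of the parameter record are bounded by its code length. [folklore] -/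
theorem params_le_length (P : UParams) :
    P.D ≤ (paramsE P).length ∧ P.L ≤ (paramsE P).length ∧ P.W ≤ (paramsE P).length ∧ P.bB ≤ (paramsE P).length ∧
      P.Wf ≤ (paramsE P).length ∧ P.Wa ≤ (paramsE P).length ∧ P.amax ≤ (paramsE P).length ∧ P.K₀ ≤ (paramsE P).length + 4 := by
  have h : (paramsE P).length = 2 * P.D + 2 + (2 * P.L + 2 + (2 * P.κ + 2 + (2 * P.W + 2 + (2 * P.bB + 2 + (2 * P.Wf + 2 + (2 * P.Wa + 2)))))) := by
    simp only [paramsE, paramsFields, rawE_cons, rawE_nil, length_boolPair, length_unE, List.length_nil]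
  unfold UParams.amax UParams.K₀
  omega

/-- A crude polynomial bound for `dataSize P K t` when all of `D`, `size amax`, `K`, `t` are at most
`4N + 4`. [folklore] -/
theorem dataSize_le_poly (P : UParams) {K t N : ℕ} (hD : P.D ≤ N) (hA : P.amax ≤ N) (hK : K ≤ 4 * N + 4) (ht : t ≤ N) :
    dataSize P K t ≤ 4000 * (N + 1) ^ 3 := by
  have hsz : Nat.size P.amax ≤ N := (size_mono hA).trans (Nat.size_le.2 Nat.lt_two_pow_self)
  have h1 : P.D * (6 * K + 6) ≤ 30 * (N + 1) ^ 2 := by nlinarith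
  have h2 : t * (2 * (P.D * (6 * K + 6)) + 2) ≤ 62 * (N + 1) ^ 3 := by nlinarith
  have hscr : scrSize P K t ≤ 500 * (N + 1) ^ 3 := by unfold scrSize; nlinarith
  have h3 : t * (2 * (4 * (P.D * (6 * K + 6)) + 4 * Nat.size P.amax + 2 * K + 34) + 2) ≤ 400 * (N + 1) ^ 3 := by nlinarith
  unfold dataSize; nlinarith

/-- The context of the replay: parameters and answers. [folklore] -/
private abbrev StE : UParams × List Bool → List Bool := pairE paramsE strE

/-- `amax` in unary. [folklore] -/
theorem params_amax : CodeFP paramsE unE UParams.amax :=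
  (unAdd.comp ((unAdd.comp ((unAdd.comp (params_D.pair params_L)).pair params_Wf)).pair params_Wa)).congr fun P => by
    simp only [UParams.amax]

/-- The guard on task arguments, from `(τ, 1ᴬ)`. [folklore] -/
theorem argsLeBFP : CodeFP (pairE taskE unE) bitE (fun p => argsLeB p.1 p.2) :=
  ((all (natLeUn.comp ((snd _ _).pair (fst _ _)))).comp ((snd _ _).pair (task_args.comp (fst _ _)))).congr fun p => by
    simp only [argsLeB]

/-- **The replay step is computed in polynomial time.** [cite: FournierKoiran2000, §2.1] -/
theorem ustepFP : CodeFP (pairE StE (pairE (pairE natE taskE) dataE)) dataE (fun t => ustep t.1.1 t.1.2 t.2.1 t.2.2) := by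
  have hP : CodeFP (pairE StE (pairE (pairE natE taskE) dataE)) paramsE (fun t => t.1.1) := (fst _ _).fst'
  have hprev : CodeFP (pairE StE (pairE (pairE natE taskE) dataE)) strE (fun t => t.1.2) := (fst _ _).snd'
  have hi : CodeFP (pairE StE (pairE (pairE natE taskE) dataE)) natE (fun t => t.2.1.1) := (snd _ _).fst'.fst'
  have hτ : CodeFP (pairE StE (pairE (pairE natE taskE) dataE)) taskE (fun t => t.2.1.2) := (snd _ _).fst'.snd'
  have hd : CodeFP (pairE StE (pairE (pairE natE taskE) dataE)) dataE (fun t => t.2.2) := (snd _ _).snd'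
  have hb : CodeFP (pairE StE (pairE (pairE natE taskE) dataE)) bitE (fun t => t.1.2.getD t.2.1.1 false) := (strGetDNat.comp (hprev.pair hi) :)
  have hguard : CodeFP (pairE StE (pairE (pairE natE taskE) dataE)) bitE
      (fun t => decide (t.2.1.1 < t.1.2.length) && argsLeB t.2.1.2 t.1.1.amax) :=
    ((natLt.comp (hi.pair (strNatLength.comp hprev))).and (argsLeBFP.comp (hτ.pair (params_amax.comp hP))) :)
  have hupd : CodeFP (pairE StE (pairE (pairE natE taskE) dataE)) dataE (fun t => uupd t.1.1 t.2.2 t.2.1.2 (t.1.2.getD t.2.1.1 false)) :=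
    (uupdFP.comp (hP.pair (hd.pair (hτ.pair hb))) :)
  exact (hguard.ite hupd hd).congr fun t => by simp only [ustep]

/-- **The replayed state is computed in polynomial time** from `(P, prev)`: a fold whose accumulator
has polynomially bounded code along the run (`usz_ustep_foldl`, `length_dataE_le`).
[cite: FournierKoiran2000, §2.2 (all the data have polynomial size), Thm 3 (p. 11)] -/
theorem ustateFP : CodeFP StE dataE (fun p => ustate p.1 p.2) := by
  have hinit : CodeFP StE dataE (fun p => UData.init p.1.D) :=
    (data_mk (const StE false) (const StE false) (zeroVec.comp (params_D.comp (fst _ _))) (const StE ([] : List ULevelRec))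
      (scrInitFP.comp (params_D.comp (fst _ _)))).congr fun p => rfl
  have hfold := foldl (σ := UParams × List Bool) (α := ℕ × UTask) (β := UData) (eσ := StE) (eα := pairE natE taskE) (eβ := dataE)
    (step := fun s t d => ustep s.1 s.2 t d) (init := fun s => UData.init s.1.D) ustepFP hinit (4000 * (X + 1) ^ 3)
    (fun s l₁ l₂ => by
      obtain ⟨P, prev⟩ := s
      obtain ⟨N, hN⟩ : ∃ N, N = (pairE StE (rawE (pairE natE taskE)) ((P, prev), l₁ ++ l₂)).length := ⟨_, rfl⟩
      obtain ⟨hD, hL, hW, hbB, hWf, hWa, hA, hK₀⟩ := params_le_length P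
      have hlen : N = 2 * (2 * (paramsE P).length + 2 + prev.length) + 2 + (rawE (pairE natE taskE) (l₁ ++ l₂)).length := by
        rw [hN]
        show (boolPair (boolPair (paramsE P) prev) (rawE _ (l₁ ++ l₂))).length = _
        rw [length_boolPair, length_boolPair]
      have hraw : l₁.length ≤ (rawE (pairE natE taskE) (l₁ ++ l₂)).length :=
        le_trans (by simp) (length_le_length_rawE _ (l₁ ++ l₂))
      have hPN : (paramsE P).length ≤ N := by omega
      have hl₁ : l₁.length ≤ N := by omega
      have h0 : USz P (P.K₀ + 3 * 0) 0 (UData.init P.D) := usz_init P _ 0 (by unfold UParams.K₀; omega)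
      have hinv := usz_ustep_foldl P prev le_rfl l₁ 0 (UData.init P.D) h0
      simp only [Nat.zero_add] at hinv
      rw [← hN]
      refine (length_dataE_le hinv).trans ((dataSize_le_poly P (N := N) (hD.trans hPN) (hA.trans hPN) (by omega) hl₁).trans ?_)
      simp)
  exact (hfold.comp ((CodeFP.id StE).pair ((rawEnum taskE).comp (uagendaFP.comp (fst _ _))))).congr fun p => by
    simp only [ustate, id]

end State

end FKPointLocation

end Literature.Computability.Complexity
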